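import Literature.MathematicalPhysics.QuantumFieldTheory.Balaban1983to89.Node00.Record8
import Literature.MathematicalPhysics.QuantumFieldTheory.Balaban1983to89.Node00.N24Glue

/-!
# NODE 00 (YM-PLAN Track A) — STAGE 8: the record predicate `Node00.IsRecordOfRecord₈C` IS INHABITED (every four-torus family `F`,
# every `N ≥ 1`), and WHAT THE CHEAP INHABITANT IS: at the zero Lie-algebra chart `ρ8 = 0` the Stage-8 β-functions of record
# VANISH IDENTICALLY, the flow is the constant one, `EndpointExistence` holds and the log-running (0.31) of [I] Thm 2 fails

HONEST FRAMING.  Count-neutral KERNEL BOOKKEEPING about NODE 00's Stage-8 record predicate (`Node00/Record8.lean`, p414247); THEOREMS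
ONLY; no definition, no estimate, nothing of Bałaban's asserted or refuted; no node discharged.  Seat `pub-ymgap-dag-n23-b` g2 (HUMAN RULING
D-0062; DAG node N23 = binder B1 is DISCHARGED OF RECORD, chair R439 — this module is the seat's datum-lane follow-up), answering referee
dag-ref-D g7's note N-rec8-1 («no tree decl inhabits `IsRecordOfRecord₈C`; a PASS-AT-STAGE-8 needs an `INHABITED-AT-8: <decl>`»; pub-ymgap
INBOX l.10148) and re-running the seat's R433 junk-exclusion test (memo `HOME/pub-ymgap-dag-n23-b/BETA-OF-RECORD-RECON.md` §3) against the
LANDED Stage 8.  Pattern of n08-a's `B10LeafUnpinnedRecord5C.exists_isRecordOfRecord₅C_b10` (INHABITED-AT-₅C, cited by R439).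

* §1 `solveCoupling_one_div_sq`, `genSeq_zeroHBeta` — with the zero β-functions the forward-generated couplings (0.20) are CONSTANT, `g_k = g₀`
  (`g₀ > 0`).
* §2 THE ZERO CHART.  `polScalar_zeroChart` ∕ `polLimit_zeroChart` ∕ `betaMerged_zeroChart` ∕ `beta0OfMerged_zeroHBeta` ∕ `betaOfMerged_zeroHBeta` ∕
  `betaOfTerms_zeroChart`: print's chart `B ↦ ℰ(exp ρB)` (`B12PolarizationTensor120.expChart`) is the CONSTANT functional `ℰ(1)` when `ρ = 0`, so the
  Hessian (1.20) vanishes, the windowed kernels (1.21) vanish, their `limUnder` is `0`, the second moment (1.22) is `0`, the one-loop number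
  `beta0OfMerged` (a `limUnder` of the constant `0`) is `0`: EVERY β-layer definition of `Node00/BetaOfRecord.lean` returns the zero β-functions
  `T4FiniteEpsInhabited.zeroHBeta` at the zero chart, whatever the term families.  Hence `betaOfRecord₈_of_zeroChart`: for Stage-8 parameters `θ`
  with `θ.ρ8 = 0`, `Node00.betaOfRecord₈ F N θ = zeroHBeta` — the datum's `βfun` (`βfun_stage8`) is the FLAT machine's.
* §3 INHABITATION.  `exists_admissible_stage8Params_zeroChart γ hγ`: admissible Stage-8 parameters exist with `D = 4`, any prescribed box radius
  `θ.γ = γ > 0`, and the zero chart (`Vβ := ℝ`, `ιβ := Unit`, `ρ8 := 0`, `bV :=` the singleton basis, `v₀ := 0`, `εbg := 1`, def-R's numeric windows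
  `ε₀ = εreg = A₀ = 1`, `M₁ = M₂ = 1`, `rep :=` def-R's `trivialRepOfRecord`, the Stage-3 parameters of `Node00.N24Glue.N24_exists_stage3Params`, the
  residual carriers the DEGENERATE inhabitants of `Node00.Satisfiable` — NOT objects of record, exactly as in the ₅C witness); `isRecordOfRecord₈C_of_eq`
  (pointed form: every admissible `θ` with a world bound to its construction, a window `0 < w.γ ≤ θ.γ`, `θ.L` and `upOfRecord₅C` IS a Stage-8 record);
  `exists_world_isRecordOfRecord₈C` (such a world exists for every admissible `θ` and every window); **`exists_isRecordOfRecord₈C`** (THE INHABITED-AT-₈C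
  DECL), `exists_isRecordOfRecord₈C_window`, and the refinement's corollary `exists_isRecordOfRecord₇C` (₅C: `Node00.N24_exists_isRecordOfRecord₅C`, n08-a's `…₅C_b10`).
* §4 THE CHEAP INHABITANT READ THROUGH THE β-SIDE BINDERS (R433 (a)(b) regression AT STAGE 8, kernel form).  At every zero-chart `θ`: the datum's
  `βfun = zeroHBeta` (`βfun_datumOfRecord₈_of_zeroChart`), every run with `g₀ > 0` has constant couplings (`flow_g_datumOfRecord₈_of_zeroChart`),
  `DagBinding.EndpointExistence` HOLDS (`endpointExistence_datumOfRecord₈_of_zeroChart` — junk-true, as at Stage 0's flat datum) and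
  `B12.Thm2Printed … L` FAILS for every `L > 1` (`not_thm2Printed_datumOfRecord₈_of_zeroChart` — (0.31) forces `β·log L ≤ 0` on the one-step run);
  packaged over the record predicate: `exists_isRecordOfRecord₈C_flatBeta` (a Stage-8 record whose datum has zero β-functions, constant flows,
  endpoint existence and NO log-running).  READING (for NODE 00's Stage 9 and the rev-1 restate, director-ym LINE №17 ∕ chair R433): Stage 8 pins β as
  a FUNCTION of `(χ₇, εbg, Vβ, ρ8, bV, v₀)` (`Record8.betaOfRecord₈`), but `Stage8Params.Admissible` (= Stage-7 admissibility ∧ `0 < εbg`) puts NO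
  clause on the chart `(Vβ, ρ8, bV)` — print differentiates (1.20) along `B ∈ su(N)` through `exp iB`; until the chart is PINNED to the inclusion
  `su(N) ↪ M_N(ℂ)` with a trace-orthonormal basis (or an admissibility clause excludes degenerate charts), an `∃`-clause over `IsRecordOfRecord₈C` reading
  only the flow (`EndpointExistence`, the window) is junk-satisfiable and a `∀`-clause demanding (0.31) is refutable, by THIS inhabitant.  Nothing here
  bears on binder B1 (N23 reads `D.av` only) or on the K-level nodes.
[Balaban1987RG1] = T. Bałaban, *Renormalization group approach to lattice gauge field theories. I*, Commun. Math. Phys. **109** (1987) 249–301,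
(0.20) p. 256, Thm 2 (0.31) p. 259, (1.20)–(1.22) p. 264, (2.12)–(2.14) p. 268; [Balaban1989LargeFieldII] Thm 1 p. 355 (the interval constant γ).
One finite four-torus family at fixed ε per run; NOTHING about the continuum limit, ℝ⁴, OS axioms, a mass gap or the Clay problem is proved or claimed.
-/

noncomputable section

open MeasureTheory Filter
open scoped Matrix.Norms.L2Operator

namespace Literature.MathematicalPhysics.QuantumFieldTheory.Balaban1983to89.Node00.Record8Inhabited

open FlowStep FlowStepRuns T4DatumAssembly
open T4Continuum (T4Family FiniteEpsData)
open T4FiniteEpsInhabited (zeroHBeta)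
open DagBinding (WorldP EndpointExistence)
open B12PolarizationTensor120 (polComp polTensor expChart)

/-! ## §1. Constant couplings under the zero β-functions -/

/-- The positive solution of `1/g'² = 1/g²` is `g` (`g > 0`). [cite: Balaban1987RG1, (0.20) p.256 (bookkeeping)] -/
theorem solveCoupling_one_div_sq {g : ℝ} (hg : 0 < g) : solveCoupling (1 / g ^ 2) = g := by
  have hy : 0 < 1 / g ^ 2 := by positivity
  rw [solveCoupling, if_pos hy, one_div (g ^ 2), Real.sqrt_inv, Real.sqrt_sq hg.le, one_div, inv_inv]

/-- **With the zero β-functions the couplings generated forward by (0.20) are CONSTANT**: `g_k = g₀` for `g₀ > 0`.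
[cite: Balaban1987RG1, (0.18)–(0.20) pp.255–256 (bookkeeping at `β ≡ 0`)] -/
theorem genSeq_zeroHBeta {g₀ : ℝ} (hg : 0 < g₀) : ∀ k : ℕ, genSeq zeroHBeta g₀ k = g₀
  | 0 => genSeq_zero _ _
  | k + 1 => by
    rw [genSeq_succ, genSeq_zeroHBeta hg k]
    show solveCoupling (1 / g₀ ^ 2 - 0) = g₀
    rw [sub_zero, solveCoupling_one_div_sq hg]

/-! ## §2. The β-layer of `Node00/BetaOfRecord.lean` at the ZERO CHART `ρ = 0` -/

section ZeroChart

variable {𝔄 : Type*} [NormedRing 𝔄] [NormedAlgebra ℝ 𝔄]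
variable {V : Type*} [NormedAddCommGroup V] [NormedSpace ℝ V] {ι : Type*} [Fintype ι]

omit [Fintype ι] in
/-- With the zero chart, print's `B ↦ ℰ(exp ρB)` is the CONSTANT functional `B ↦ ℰ(1)` (`exp 0 = 1`).
[cite: Balaban1987RG1, p.264 (before (1.20); bookkeeping at `ρ = 0`)] -/
theorem expChart_zeroChart {Λ T : Type*} (ℰ : (Λ → T → 𝔄) → ℝ) :
    expChart ℰ (0 : V →L[ℝ] 𝔄) = fun _ : Λ → T → V => ℰ (fun _ _ => 1) := by
  funext B
  simp only [B12PolarizationTensor120.expChart_apply, zero_apply, NormedSpace.exp_zero]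

omit [Fintype ι] in
/-- The Hessian (1.20) of a constant functional vanishes. [cite: Balaban1987RG1, (1.20) p.264 (bookkeeping)] -/
theorem polTensor_const {Λ T : Type*} [Fintype Λ] [Fintype T] [DecidableEq Λ] [DecidableEq T] (c : ℝ) (μ : Λ) (x : T)
    (v : V) (ν : Λ) (y : T) (w : V) : polTensor ℝ (fun _ : Λ → T → V => c) μ x v ν y w = 0 := by
  simp only [B12PolarizationTensor120.polTensor, fderiv_fun_const, fderiv_zero, Pi.zero_apply, zero_apply]

/-- **(1.20)–(1.21)₁ at the zero chart: the scalar kernel VANISHES** (the chart is constant, its Hessian is `0`).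
[cite: Balaban1987RG1, (1.20)–(1.21) p.264 (bookkeeping at `ρ = 0`)] -/
theorem polScalar_zeroChart {Λ T : Type*} [Fintype Λ] [Fintype T] [DecidableEq Λ] [DecidableEq T]
    (ℰ : (Λ → T → 𝔄) → ℝ) (bV : Module.Basis ι ℝ V) (μ : Λ) (x : T) (ν : Λ) (y : T) :
    polScalar ℰ (0 : V →L[ℝ] 𝔄) bV μ x ν y = 0 := by
  simp only [polScalar, B12PolarizationTensor120.polComp, expChart_zeroChart, polTensor_const, Finset.sum_const_zero, mul_zero]

/-- (1.21) windowed into `ℤ⁴`, at the zero chart: `0`. [cite: Balaban1987RG1, (1.21) p.264 (bookkeeping at `ρ = 0`)] -/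
theorem polWindow_zeroChart (F : T4Family) (K j : ℕ) (ℰ : (Fin (F.P K).d → Site (F.P K) j → 𝔄) → ℝ)
    (bV : Module.Basis ι ℝ V) (μ ν : Fin 4) (z : Fin 4 → ℤ) :
    polWindow F K j ℰ (0 : V →L[ℝ] 𝔄) bV μ ν z = 0 :=
  polScalar_zeroChart _ _ _ _ _ _

/-- **The limit «T^{(j+1)} ↗ Z^d» (1.21), reading (c3), at the zero chart is the ZERO kernel** (`limUnder` of the constant `0`).
[cite: Balaban1987RG1, (1.21) p.264 (bookkeeping at `ρ = 0`)] -/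
theorem polLimit_zeroChart (F : T4Family) (j : ℕ) (ℰ : (K : ℕ) → (Fin (F.P K).d → Site (F.P K) j → 𝔄) → ℝ)
    (bV : Module.Basis ι ℝ V) : polLimit F j ℰ (0 : V →L[ℝ] 𝔄) bV = fun _ _ _ => 0 := by
  funext μ ν z
  simp only [polLimit, polWindow_zeroChart]
  exact tendsto_const_nhds.limUnder_eq

/-- The second moment (1.22) of the zero kernel is `0`. [cite: Balaban1987RG1, (1.22) p.264 (bookkeeping)] -/
theorem secondMoment_zeroKernel {d : ℕ} (μ ν : Fin d) : B12Beta.secondMoment (fun _ _ _ => (0 : ℝ)) μ ν = 0 := by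
  simp only [B12Beta.secondMoment, zero_mul, tsum_zero]

/-- **β_merged at the zero chart is the ZERO β-function family**, whatever the term family. [cite: Balaban1987RG1, (1.22) p.264 (bookkeeping at `ρ = 0`)] -/
theorem betaMerged_zeroChart (F : T4Family) (ℰ : TermFamily1 F 𝔄) (bV : Module.Basis ι ℝ V) :
    betaMerged F ℰ (0 : V →L[ℝ] 𝔄) bV = zeroHBeta := by
  funext k hist
  simp only [betaMerged, polLimit_zeroChart, secondMoment_zeroKernel]
  rfl

/-- `β⁰` of (1.22) from the coupling-free term family at the zero chart is `0`. [cite: Balaban1987RG1, (1.22) p.264 and (2.12) p.268 (bookkeeping at `ρ = 0`)] -/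
theorem beta0OfTerms_zeroChart (F : T4Family) (ℰ0 : TermFamily0 F 𝔄) (bV : Module.Basis ι ℝ V) :
    beta0OfTerms F ℰ0 (0 : V →L[ℝ] 𝔄) bV = fun _ => 0 := by
  funext k
  simp only [beta0OfTerms, polLimit_zeroChart, secondMoment_zeroKernel]

/-- `β¹` of (1.22) from the remainder family at the zero chart is `0`. [cite: Balaban1987RG1, (1.22) p.264 and (2.13) p.268 (bookkeeping at `ρ = 0`)] -/
theorem beta1OfTerms_zeroChart (F : T4Family) (ℰ1 : TermFamily1 F 𝔄) (bV : Module.Basis ι ℝ V) :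
    beta1OfTerms F ℰ1 (0 : V →L[ℝ] 𝔄) bV = fun _ _ => 0 := by
  funext k hist
  simp only [beta1OfTerms, polLimit_zeroChart, secondMoment_zeroKernel]

/-- **n09-b's two-family β of record `betaOfTerms` at the zero chart is the ZERO family** (dag-n23-b g0's memo §3, now for ANY term
families once the chart degenerates). [cite: Balaban1987RG1, (1.22) p.264 (bookkeeping at `ρ = 0`)] -/
theorem betaOfTerms_zeroChart (F : T4Family) (ℰ0 : TermFamily0 F 𝔄) (ℰ1 : TermFamily1 F 𝔄) (bV : Module.Basis ι ℝ V) (γ : ℝ) :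
    betaOfTerms F ℰ0 ℰ1 (0 : V →L[ℝ] 𝔄) bV γ = zeroHBeta := by
  funext k hist
  show betaOfTerms F ℰ0 ℰ1 0 bV γ k hist = 0
  by_cases hm : hist ∈ Box γ k
  · simp only [betaOfTerms_of_mem _ _ _ _ _ _ hm, beta0OfTerms_zeroChart, beta1OfTerms_zeroChart, add_zero]
  · simp only [betaOfTerms, Set.indicator_of_notMem hm, beta0OfTerms_zeroChart, add_zero]

end ZeroChart

/-- The one-loop number `beta0OfMerged` (a `limUnder (𝓝[>] 0)`) of the zero family is `0`. [cite: Balaban1987RG1, (2.12)–(2.14) p.268 (bookkeeping)] -/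
theorem beta0OfMerged_zeroHBeta (v₀ : (k : ℕ) → (Fin (k + 1) → ℝ)) : beta0OfMerged zeroHBeta v₀ = fun _ => 0 := by
  funext k
  show limUnder _ (fun _ : ℝ => (0 : ℝ)) = 0
  exact tendsto_const_nhds.limUnder_eq

/-- The β of record `betaOfMerged` built from the zero family and zero one-loop numbers is the zero family, for every box radius.
[cite: Balaban1987RG1, (1.22) p.264 (bookkeeping)] -/
theorem betaOfMerged_zeroHBeta (γ : ℝ) : betaOfMerged zeroHBeta (fun _ => 0) γ = zeroHBeta := by
  funext k v
  show betaOfMerged zeroHBeta (fun _ => 0) γ k v = 0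
  by_cases hv : v ∈ Box γ k
  · rw [betaOfMerged_of_mem _ _ _ hv]; rfl
  · rw [betaOfMerged_of_notMem _ _ _ hv]

variable (F : T4Family) (N : ℕ) [NeZero N]

/-- **THE STAGE-8 β OF RECORD AT A ZERO CHART IS IDENTICALLY ZERO**: for Stage-8 parameters `θ` with `θ.ρ8 = 0`,
`Node00.betaOfRecord₈ F N θ = zeroHBeta` — whatever `χ₇`, `εbg`, `bV`, `v₀`, `γ`. (`Stage8Params.Admissible` does not exclude such `θ`:
§3.) [cite: Balaban1987RG1, (1.20)–(1.22) p.264 (bookkeeping at `ρ = 0`)] -/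
theorem betaOfRecord₈_of_zeroChart (θ : Stage8Params F N) (h : letI := θ.instVβ₁; letI := θ.instVβ₂; θ.ρ8 = 0) :
    betaOfRecord₈ F N θ = zeroHBeta := by
  letI := θ.instVβ₁; letI := θ.instVβ₂; letI := θ.instιβ
  unfold betaOfRecord₈
  rw [h, betaMerged_zeroChart, beta0OfMerged_zeroHBeta, betaOfMerged_zeroHBeta]

/-! ## §3. `IsRecordOfRecord₈C` is inhabited -/

/-- **Admissible Stage-8 parameters EXIST**, with `D = 4`, any prescribed box radius `γ > 0`, and the ZERO chart (`Vβ := ℝ`, `ιβ := Unit`,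
`ρ8 := 0`; `εbg := 1`; def-R's windows `ε₀ = εreg = A₀ = 1`, `M₁ = M₂ = 1`; `rep := trivialRepOfRecord`; DEGENERATE residual carriers as in
`Node00.Satisfiable` — NOT objects of record). [cite: Balaban1987RG1, (0.21) p.256 and (1.20)–(1.22) p.264; Balaban1988Convergent, (2.4)–(2.5) p.255, (2.13)–(2.17) pp.256–257; Balaban1989LargeFieldII, Thm 1 p.355 (parameter dictionary; bookkeeping witness)] -/
theorem exists_admissible_stage8Params_zeroChart (γ : ℝ) (hγ : 0 < γ) :
    ∃ θ : Stage8Params F N, θ.Admissible ∧ θ.D = 4 ∧ θ.γ = γ ∧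
      (letI := θ.instVβ₁; letI := θ.instVβ₂; θ.ρ8 = 0) := by
  obtain ⟨θ₃, hθ₃, hD⟩ := N24_exists_stage3Params
  obtain ⟨X⟩ := nonempty_printedCarriersR
  obtain ⟨Y⟩ := nonempty_printedCarriers9X
  obtain ⟨Z⟩ := nonempty_printedCarriers11
  obtain ⟨V⟩ := nonempty_printedCarriers14R
  obtain ⟨W⟩ := nonempty_printedCarriers15
  let res : Residual₅ F N :=
    { X := fun _ => X, Y := fun _ => Y, Z := fun _ => Z, V := fun _ => V, W := fun _ => W, βfun := zeroHBeta, E := fun _ => 0,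
      dom := fun _ _ => ∅, effAction := fun _ _ _ => 0, wilsonBG := fun _ _ _ => 0, Ek := fun _ _ _ => 0, χ := fun _ _ _ => 0,
      S218 := fun _ _ _ => False, ReprA := fun _ _ _ _ _ _ _ => False, IndA := fun _ _ _ _ _ _ _ => False, R := fun _ _ => id,
      preservesIntegral_R := fun _ _ _ _ => rfl, integrable_R := fun _ _ _ _ h => h }
  let ν : Stage7Numerics := { M₁ := 1, M₂ := 1, r := 0, p₀ := 0, A₀ := 1, logσ₀ := 0, εreg := 1, ε₀ := 1 }
  refine ⟨{ θ₃ with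
      γ := γ, res := res, ν := ν, rep := trivialRepOfRecord F N, Efl := fun _ _ => 0, logz := fun _ _ => 0,
      εbg := 1, Vβ := ℝ, ιβ := Unit, ρ8 := 0, bV := Module.Basis.singleton Unit ℝ, v₀ := fun _ _ => 0 }, ?_, hD, rfl, rfl⟩
  exact ⟨⟨⟨hθ₃, hγ⟩, one_pos, one_pos, one_pos, le_rfl, le_rfl⟩, one_pos⟩

/-- Admissible Stage-8 parameters exist (plain form). [cite: Balaban1987RG1, (0.21) p.256 (bookkeeping witness)] -/
theorem exists_admissible_stage8Params : ∃ θ : Stage8Params F N, θ.Admissible ∧ θ.D = 4 := by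
  obtain ⟨θ, hθ, hD, -, -⟩ := exists_admissible_stage8Params_zeroChart F N 1 one_pos
  exact ⟨θ, hθ, hD⟩

/-- **Pointed form of the record predicate**: at admissible Stage-8 parameters, the Stage-8 datum together with ANY world bound to its
construction, with a window `0 < w.γ ≤ θ.γ`, block size `θ.L` and the upstream block of record, IS a Stage-8 record (C-binding).
[cite: Balaban1989LargeFieldII, Thm 1 + (0.1) pp.355–356 (objects of record, bookkeeping)] -/
theorem isRecordOfRecord₈C_of_eq (θ : Stage8Params F N) (hθ : θ.Admissible) (w : WorldP)
    (hC : w.C = (datumOfRecord₅ F N (θ.toStage5 F N)).C) (hγ : 0 < w.γ ∧ w.γ ≤ θ.γ) (hL : w.L = (θ.L : ℝ))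
    (hup : ∀ P, w.up P = upOfRecord₅C F N (θ.toStage5 F N) P) :
    IsRecordOfRecord₈C F N (datumOfRecord₅ F N (θ.toStage5 F N)) w :=
  ⟨θ, hθ, rfl, hC, hγ, hL, hup⟩

/-- **Every admissible Stage-8 parameter's datum IS a Stage-8 record at some world**, with any prescribed window `0 < γw ≤ θ.γ` (the world:
any binding world re-bound to the datum's construction, `γw`, `θ.L` and `upOfRecord₅C`). [cite: Balaban1989LargeFieldII, Thm 1 + (0.1) pp.355–356 (bookkeeping)] -/
theorem exists_world_isRecordOfRecord₈C (θ : Stage8Params F N) (hθ : θ.Admissible) {γw : ℝ} (hγw : 0 < γw ∧ γw ≤ θ.γ) :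
    ∃ w : WorldP, IsRecordOfRecord₈C F N (datumOfRecord₅ F N (θ.toStage5 F N)) w ∧ w.γ = γw := by
  obtain ⟨w₀⟩ := nonempty_worldP
  exact ⟨{ w₀ with
      C := (datumOfRecord₅ F N (θ.toStage5 F N)).C, γ := γw, L := (θ.L : ℝ), one_lt_L := by exact_mod_cast θ.hL.2,
      up := fun P => upOfRecord₅C F N (θ.toStage5 F N) P },
    ⟨θ, hθ, rfl, rfl, hγw, rfl, fun _ => rfl⟩, rfl⟩

/-- **INHABITED-AT-₈C**: for every four-torus family `F` and every `N ≥ 1` there is a Stage-8 record `(D, w)` — `Node00.IsRecordOfRecord₈C F N D w`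
(dag-ref-D N-rec8-1; the witness of `exists_admissible_stage8Params_zeroChart` at `γ = 1` with its own world; DEGENERATE, not an object of record).
[cite: Balaban1987RG1, (0.17)–(0.22) pp.255–256 and (1.20)–(1.22) p.264; Balaban1989LargeFieldII, Thm 1 p.355 (objects of record, Stage 8; bookkeeping witness)] -/
theorem exists_isRecordOfRecord₈C : ∃ (D : FiniteEpsData F (SU N)) (w : WorldP), IsRecordOfRecord₈C F N D w := by
  obtain ⟨θ, hθ, -, hγ, -⟩ := exists_admissible_stage8Params_zeroChart F N 1 one_pos
  obtain ⟨w, hw, -⟩ := exists_world_isRecordOfRecord₈C F N θ hθ (γw := 1) ⟨one_pos, by rw [hγ]⟩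
  exact ⟨_, w, hw⟩

/-- Stage-8 records exist with any prescribed record box `θ.γ = γ` and any window `0 < γw ≤ γ` of the binding world.
[cite: Balaban1989LargeFieldII, Thm 1 p.355 (bookkeeping witness)] -/
theorem exists_isRecordOfRecord₈C_window {γ γw : ℝ} (h0 : 0 < γw) (hle : γw ≤ γ) :
    ∃ (D : FiniteEpsData F (SU N)) (w : WorldP), IsRecordOfRecord₈C F N D w ∧ w.γ = γw := by
  obtain ⟨θ, hθ, -, hγ, -⟩ := exists_admissible_stage8Params_zeroChart F N γ (h0.trans_le hle)
  obtain ⟨w, hw, hwγ⟩ := exists_world_isRecordOfRecord₈C F N θ hθ (γw := γw) ⟨h0, by rw [hγ]; exact hle⟩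
  exact ⟨_, w, hw, hwγ⟩

/-- INHABITED-AT-₇C (through the refinement `IsRecordOfRecord₈C → IsRecordOfRecord₇C`). [cite: Balaban1988Convergent, (2.16)–(2.17) p.257 (bookkeeping witness)] -/
theorem exists_isRecordOfRecord₇C : ∃ (D : FiniteEpsData F (SU N)) (w : WorldP), IsRecordOfRecord₇C F N D w := by
  obtain ⟨D, w, h⟩ := exists_isRecordOfRecord₈C F N
  exact ⟨D, w, isRecordOfRecord₇C_of_isRecordOfRecord₈C h⟩

/-! ## §4. The cheap inhabitant read through the β-side binders (R433 regression at Stage 8) -/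

/-- At a zero-chart Stage-8 parameter the datum's β-functions ARE the zero family. [cite: Balaban1987RG1, (1.20)–(1.22) p.264 (bookkeeping at `ρ = 0`)] -/
theorem βfun_datumOfRecord₈_of_zeroChart (θ : Stage8Params F N) (h : letI := θ.instVβ₁; letI := θ.instVβ₂; θ.ρ8 = 0) :
    (datumOfRecord₅ F N (θ.toStage5 F N)).βfun = zeroHBeta := by
  rw [βfun_stage8, betaOfRecord₈_of_zeroChart F N θ h]

/-- … so every run started at `g₀ > 0` has CONSTANT couplings `g_k = g₀`. [cite: Balaban1987RG1, (0.18)–(0.20) pp.255–256 (bookkeeping at `β ≡ 0`)] -/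
theorem flow_g_datumOfRecord₈_of_zeroChart (θ : Stage8Params F N) (h : letI := θ.instVβ₁; letI := θ.instVβ₂; θ.ρ8 = 0)
    (p : B12.RunParams) (hp : 0 < p.g0) (k : ℕ) : ((datumOfRecord₅ F N (θ.toStage5 F N)).C p).flow.g k = p.g0 := by
  rw [flow_stage8, betaOfRecord₈_of_zeroChart F N θ h]
  exact genSeq_zeroHBeta hp k

/-- The initial coupling of every run is the bare one (no positivity needed). [cite: Balaban1987RG1, (0.17) p.255 (bookkeeping)] -/
theorem flow_g_zero_datumOfRecord₈ (θ : Stage8Params F N) (p : B12.RunParams) :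
    ((datumOfRecord₅ F N (θ.toStage5 F N)).C p).flow.g 0 = p.g0 := by
  rw [flow_stage8]
  exact genSeq_zero _ _

/-- **`EndpointExistence` HOLDS at every zero-chart Stage-8 datum** (junk-true: the constant run started at `g₀ = g ≤ γ ≤ 1` stays in `]0, γ]` and
ends at `g`) — the Stage-0 phenomenon of `BalabanUVNodesStage0FlatWitness.endpointExistence_flat` INSIDE the Stage-8 record class.
[cite: Balaban1987RG1, Thm 2 p.259 (endpoint clause, typed form; bookkeeping)] -/
theorem endpointExistence_datumOfRecord₈_of_zeroChart (θ : Stage8Params F N) (h : letI := θ.instVβ₁; letI := θ.instVβ₂; θ.ρ8 = 0) :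
    EndpointExistence (datumOfRecord₅ F N (θ.toStage5 F N)).C.toB12 := by
  intro m
  refine ⟨1, one_pos, fun γ hγ _ => ⟨γ, hγ, fun g hg hgγ K => ⟨g, fun k _ => ?_, ?_⟩⟩⟩
  · show 0 < ((datumOfRecord₅ F N (θ.toStage5 F N)).C ⟨K, m, g⟩).flow.g k ∧
      ((datumOfRecord₅ F N (θ.toStage5 F N)).C ⟨K, m, g⟩).flow.g k ≤ γ
    rw [flow_g_datumOfRecord₈_of_zeroChart F N θ h ⟨K, m, g⟩ hg k]
    exact ⟨hg, hgγ⟩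
  · show ((datumOfRecord₅ F N (θ.toStage5 F N)).C ⟨K, m, g⟩).flow.g K = g
    exact flow_g_datumOfRecord₈_of_zeroChart F N θ h ⟨K, m, g⟩ hg K

/-- **[I] Thm 2 WITH (0.31) FAILS at every zero-chart Stage-8 datum**, for every `L > 1`: on the one-step run (`K = 1`) the lower half of (0.31) at
`k = 0` reads `1/g² + β·log L ≤ 1/g₀²` with `g₀ = g` (constant flow), i.e. `β·log L ≤ 0`, contradicting `β > 0`.
[cite: Balaban1987RG1, Thm 2 (0.31) p.259 (typed form; bookkeeping at `β ≡ 0`)] -/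
theorem not_thm2Printed_datumOfRecord₈_of_zeroChart (θ : Stage8Params F N) (h : letI := θ.instVβ₁; letI := θ.instVβ₂; θ.ρ8 = 0)
    {L : ℝ} (hL : 1 < L) : ¬ B12.Thm2Printed (datumOfRecord₅ F N (θ.toStage5 F N)).C.toB12 L := by
  intro hT
  obtain ⟨γ₂, hγ₂, hγ⟩ := hT 0
  obtain ⟨gstar, hgstar, hg⟩ := hγ γ₂ hγ₂ le_rfl
  obtain ⟨β, β', hβ, -, hK⟩ := hg (min gstar γ₂) (lt_min hgstar hγ₂) (min_le_left _ _)
  obtain ⟨g0, hI, hend, hrun⟩ := hK 1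
  have h00 : ((datumOfRecord₅ F N (θ.toStage5 F N)).C ⟨1, 0, g0⟩).flow.g 0 = g0 := flow_g_zero_datumOfRecord₈ F N θ _
  have hg0 : 0 < g0 := by
    have := (hI 0 (Nat.zero_le 1)).1
    change 0 < ((datumOfRecord₅ F N (θ.toStage5 F N)).C ⟨1, 0, g0⟩).flow.g 0 at this
    rwa [h00] at this
  have h1 : ((datumOfRecord₅ F N (θ.toStage5 F N)).C ⟨1, 0, g0⟩).flow.g 1 = g0 :=
    flow_g_datumOfRecord₈_of_zeroChart F N θ h ⟨1, 0, g0⟩ hg0 1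
  have hg0eq : g0 = min gstar γ₂ := by
    change ((datumOfRecord₅ F N (θ.toStage5 F N)).C ⟨1, 0, g0⟩).flow.g 1 = min gstar γ₂ at hend
    rw [h1] at hend
    exact hend
  have hlow := (hrun 0 (Nat.zero_le 1)).1
  change 1 / (min gstar γ₂) ^ 2 + β * ((((1 : ℕ) : ℝ) - ((0 : ℕ) : ℝ)) * Real.log L) ≤
    1 / (((datumOfRecord₅ F N (θ.toStage5 F N)).C ⟨1, 0, g0⟩).flow.g 0) ^ 2 at hlow
  rw [h00, hg0eq, Nat.cast_one, Nat.cast_zero, sub_zero, one_mul] at hlow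
  linarith [mul_pos hβ (Real.log_pos hL)]

/-- **A Stage-8 record with ZERO β-functions, constant flows, endpoint existence and NO log-running EXISTS** (the inhabitant of §3, packaged
over the predicate): the kernel form of «`Stage8Params.Admissible` does not pin the chart `(Vβ, ρ8, bV)`» — an `∃`-clause over `IsRecordOfRecord₈C`
reading only the flow is satisfiable by it, a `∀`-clause demanding (0.31) is refuted by it.  A probe of the TYPING (the un-pinned chart), not a
statement about Bałaban's β. [cite: Balaban1987RG1, Thm 2 (0.31) p.259 and (1.20)–(1.22) p.264 (typed forms; bookkeeping)] -/
theorem exists_isRecordOfRecord₈C_flatBeta :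
    ∃ (D : FiniteEpsData F (SU N)) (w : WorldP), IsRecordOfRecord₈C F N D w ∧ D.βfun = zeroHBeta ∧
      (∀ p : B12.RunParams, 0 < p.g0 → ∀ k, (D.C p).flow.g k = p.g0) ∧
      EndpointExistence D.C.toB12 ∧ ∀ L : ℝ, 1 < L → ¬ B12.Thm2Printed D.C.toB12 L := by
  obtain ⟨θ, hθ, -, hγ, hρ⟩ := exists_admissible_stage8Params_zeroChart F N 1 one_pos
  obtain ⟨w, hw, -⟩ := exists_world_isRecordOfRecord₈C F N θ hθ (γw := 1) ⟨one_pos, by rw [hγ]⟩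
  exact ⟨_, w, hw, βfun_datumOfRecord₈_of_zeroChart F N θ hρ, fun p hp k => flow_g_datumOfRecord₈_of_zeroChart F N θ hρ p hp k,
    endpointExistence_datumOfRecord₈_of_zeroChart F N θ hρ, fun L hL => not_thm2Printed_datumOfRecord₈_of_zeroChart F N θ hρ hL⟩

end Literature.MathematicalPhysics.QuantumFieldTheory.Balaban1983to89.Node00.Record8Inhabited

end
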